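import Summits.QuantumFields.BalabanUV.Beta.GAN24.OneStepConstraintBlockPresentation
import Summits.QuantumFields.BalabanUV.Beta.GAN24.OneStepConstraintBlockGeometry

/-!
# `BalabanUV.Beta.GAN24.OneStepConstraintAxialVolumeLetters` — binder row G-an2-4 ∕ (CONV-C), routes C-R6° («VALUES») × R7 («TWO CURRENCIES»), PART 187:
# EL₂ OF THE ONE-STEP CONSTRAINT AND OF THE SOFT RESOLVENT, AT BLOCK-FIBRED READINGS.  Along cubic coarse tori `M = cubic d (s t)`, `s t → ∞`, and at the presented readings of
# PART 186 (`ρ(ẑ,(j,μ)) = (R·ẑ + j, μ)`, `ε(ẑ, inl μ) = inl (ẑ,μ)`, `ε(ẑ, inr (j,μ)) = inr (R·ẑ + j, μ)`): (1) the entries of Bałaban's averaging `QB` and of the axial projection rows are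
# EVENTUALLY CONSTANT (local stencils of finite range: PART 185's exact window), so the stacked constraint `Q_ax = fromRows (re QB) E_T` has EL₂ at every (stacked, fine) reading
# pair and its regulariser `Q_axᵀ(a•1)Q_ax` at every (fine, fine) pair (PART 185's rectangular pair product over the presented stacked index); (2) for ANY volume-indexed fine form
# `H_t` — symmetric, `γ_K`-coercive regularisation, block entry decay `(h₀, δ_H)` and EL₂ at fine readings, all UNIFORM in `t` — the regularised form `K_t = H_t + Q_axᵀ(a•1)Q_ax`
# presented over the coarse torus satisfies PART 144's three hypotheses ((a) Neumann ratio from PART 185's real-symmetric letter, (b) window decay from PART 180's entry decay, (c) EL₂),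
# hence `K_t⁻¹` HAS EL₂ AT FINE READINGS — census V201′ (ε), step 1 (unit b2b-balaban-gan24-p3, gen 61; v1)

NOT IN PRINT; OUR PROOF ([folklore] bookkeeping BY NAME over PART 144 `VolumeLimitPairsFibre.exists_tendsto_inv_pair`, PART 185 `VolumeLimitPairsRect` (`tendsto_mul_pair₃`, `eventually_castT_eq_castT_iff`,
`opNorm_one_sub_smul_map_ofReal_le`, `coercive_submatrix`, `form_le_submatrix`, `transpose_submatrix_eq`, `map_ofReal_inv`, `inv_submatrix_of_bijective`, `exp_neg_tdist_le_exp_window`), PART 186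
`OneStepConstraintBlockPresentation` (`rho_bijective`, `eps_bijective`, `cpt_castT_add_off`, `tstep_eq_castT`, `fromRows_eps_inl ∕ _inr_rho`, `abs_fromRows_le_one ∕ _le_exp`, `key_eps`), PART 180
`OneStepConstraintAxialGauges.abs_regFormAx_apply_le`, PART 181 `OneStepConstraintBlockGeometry.form_le_of_entry_decay_par`, PART 105 `EffectiveFormLocalisation` (`transpose_reg`,
`isUnit_det_of_coercive_fine`), NE2's `BalabanLineAverage.QB_apply`, PART 167 `isReal_QB`; [Balaban1987RG1] p. 264 (after (1.21)) LOCATES the `T ↗ ℤ^d` limit; nothing printed is a hypothesis).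
HONEST FRAMING (cell contract, verbatim): «discharging `BetaPertH` makes Bałaban's UV stability UNCONDITIONAL — a real constructive-QFT result; it is NOT the
continuum limit and NOT the Clay problem.»  HONEST DEPENDENCY (verbatim): «continuum YM on T⁴ ⇐ BetaPertH ∧ nine spine estimates (0/9 proved); BetaPertH ⇐
(D1) ∧ (D4) ∧ CAP+tail; G-an2-4 gates asym, D1 and NE2/3/4.»

WHAT THIS FILE PROVES (0 sorry, 0 `def`; `N, R ≥ 1`, every `d ≥ 1`, every cubic volume sequence `s t → ∞`; readings `ẑ_t = castT (fine N (cubic d (s t))) z`):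
* §1 **`tendsto_re_QB_rho`** (EL₂ of `re QB((ẑ,μ), ρ(ẑ′,f′))` — eventually constant), **`tendsto_fromRows_eps_rho`** (EL₂ of `Q_ax(ε(ẑ,g), ρ(ẑ′,f′))` for both row families),
  **`tendsto_reg_rho_rho`** (EL₂ of `(Q_axᵀ(a•1)Q_ax)(ρr̂, ρr̂′)`).
* §2 for a volume-indexed fine form `H_t` with `t`-UNIFORM letters: `regFormAx_rho_letters` ((a)(b) of PART 144 for `K_t∘(ρ,ρ) ⊗ ℂ`: Neumann ratio `1 − γ_K∕Λ_K`, `Λ_K = c_K·d·R^d·Kf(δ_H)`;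
  window decay at rate `δ_H∕d`), `tendsto_regFormAx_rho` (EL₂ of `K_t` at fine readings from EL₂ of `H_t`), **`tendsto_inv_regFormAx_rho`** — EL₂ OF `K_t⁻¹` AT FINE READINGS.
WHAT IT IS NOT: the block propagator `P`, its inverse and `𝒢` itself are PART 188; `H = re Δ_n` is PART 189.  SUPPLIER work; NEVER «G-an2-4 closed»; NOT (CONV-C), NOT D1, NOT `BetaPertH`,
NOT continuum, NOT Clay.  Records: `HOME/b2b-balaban-gan24-p3/gen61/README.md`.
-/

noncomputable section

open scoped BigOperators ComplexConjugate Matrix Matrix.Norms.L2Operator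
open Filter Topology Finset Matrix

namespace Summit.QuantumFields.BalabanUV.Beta.GAN24.OneStepConstraintAxialVolumeLetters

open Literature.MathematicalPhysics.QuantumFieldTheory.Balaban1983to89
open Literature.MathematicalPhysics.QuantumFieldTheory.Balaban1983to89.B4Sect5Torus (rate rate_pos)
open Literature.MathematicalPhysics.QuantumFieldTheory.Balaban1983to89.B12Sec2to5 (l1)
open Literature.MathematicalPhysics.QuantumFieldTheory.Balaban1983to89.B5Prop11Plancherel (Tor fine)
open Literature.MathematicalPhysics.QuantumFieldTheory.Balaban1983to89.B5RealFields (reM reM_apply IsReal)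
open Literature.MathematicalPhysics.QuantumFieldTheory.Balaban1983to89.B5Block118 (tstep)
open Literature.MathematicalPhysics.QuantumFieldTheory.Balaban1983to89.B5G183RateTorus (cpt)
open Literature.MathematicalPhysics.QuantumFieldTheory.Balaban1983to89.B5G183RateTorusW (off)
open Literature.MathematicalPhysics.QuantumFieldTheory.Balaban1983to89.Beta (Site windowMap)
open Literature.MathematicalPhysics.QuantumFieldTheory.Balaban1983to89.Beta.FreeLegDictionary (cubic)
open Literature.MathematicalPhysics.QuantumFieldTheory.Balaban1983to89.Beta.VectorTails (castT castT_add)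
open Literature.MathematicalPhysics.QuantumFieldTheory.Balaban1983to89.Beta.VectorTailsCov (tdist tdist_comm)
open Summit.QuantumFields.BalabanUV.T4Continuum.BalabanLineAverage (QB QB_apply)
open Summit.QuantumFields.BalabanUV.T4Continuum.BalabanAveragedTowerModes (par rem par_cpt_add_off rem_cpt_add_off)
open Summit.QuantumFields.BalabanUV.Beta.GAN24.FirstOrderModelRealLetters (isReal_QB)
open Summit.QuantumFields.BalabanUV.Beta.GAN24.EffectiveFormLocalisation (transpose_reg isUnit_det_of_coercive_fine transpose_mul_smul_one_mul)
open Summit.QuantumFields.BalabanUV.Beta.GAN24.OneStepConstraintBlockGeometry (form_le_of_entry_decay_par)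
open Summit.QuantumFields.BalabanUV.Beta.GAN24.OneStepConstraintAxialGauges (abs_regFormAx_apply_le tdist_key_par_le_one)
open Summit.QuantumFields.BalabanUV.Beta.GAN24.VolumeLimitPairsFibre (exists_tendsto_inv_pair)
open Summit.QuantumFields.BalabanUV.Beta.GAN24.VolumeLimitPairsRect (tendsto_mul_pair₃ eventually_castT_eq_castT_iff opNorm_one_sub_smul_map_ofReal_le coercive_submatrix form_le_submatrix
  transpose_submatrix_eq map_ofReal_inv inv_submatrix_of_bijective exp_neg_tdist_le_exp_window exp_neg_tdist_le_exp_window')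
open Summit.QuantumFields.BalabanUV.Beta.GAN24.OneStepConstraintBlockPresentation (rho_bijective rho_injective eps_bijective tree_cpt_add_off cpt_castT_add_off tstep_eq_castT
  fromRows_eps_inl fromRows_eps_inr abs_fromRows_le_one abs_fromRows_le_exp key_eps)

variable {d : ℕ} (N R : ℕ) [NeZero N] [NeZero R] (s : ℕ → ℕ) [hs0 : ∀ t, NeZero (s t)]

/-! ## §1 EL₂ of the one-step constraint at block-fibred readings -/

section Constraint

/-- **`tendsto_re_QB_rho` — BAŁABAN's AVERAGING IS EVENTUALLY CONSTANT AT INTEGER READINGS**: along `s t → ∞`, `re QB((ẑ,μ), (R·ẑ′ + j′, μ′))` is eventually the `t`-independent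
number `R^{−(d+1)}·#{(j,τ) : R z′ + j′ = R z + j + τ e_μ} · [μ′ = μ]` (the contour count of (1.11)∕(1.18) read in `ℤ^d` once the torus separates the finitely many integer vectors
involved — PART 185 `eventually_castT_eq_castT_iff`), hence convergent. [folklore] -/
theorem tendsto_re_QB_rho (hs : Tendsto s atTop atTop) (z : Fin d → ℤ) (μ : Fin d) (z' : Fin d → ℤ) (f' : (Fin d → Fin R) × Fin d) :
    ∃ c : ℝ, Tendsto (fun t => (QB N R (cubic d (s t)) (castT (fine N (cubic d (s t))) z, μ)
      (cpt N R (cubic d (s t)) (castT (fine N (cubic d (s t))) z') + off N R (cubic d (s t)) f'.1, f'.2)).re) atTop (𝓝 c) := by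
  classical
  have hRN : 1 ≤ R * N := Nat.one_le_iff_ne_zero.mpr (NeZero.ne (R * N))
  refine ⟨(((R : ℂ) ^ (d + 1))⁻¹ * ∑ j : Fin d → Fin R, ∑ τ : Fin R,
    if ((fun ν => (R : ℤ) * z' ν + ((f'.1 ν : ℕ) : ℤ)) = (fun ν => (R : ℤ) * z ν + ((j ν : ℕ) : ℤ)) + (fun ν => if ν = μ then ((τ : ℕ) : ℤ) else 0) ∧ f'.2 = μ)
      then (1 : ℂ) else 0).re, ?_⟩
  have hev : ∀ᶠ t in atTop, ∀ (j : Fin d → Fin R) (τ : Fin R),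
      (castT (cubic d (R * N * s t)) (fun ν => (R : ℤ) * z' ν + ((f'.1 ν : ℕ) : ℤ)) =
          castT (cubic d (R * N * s t)) ((fun ν => (R : ℤ) * z ν + ((j ν : ℕ) : ℤ)) + (fun ν => if ν = μ then ((τ : ℕ) : ℤ) else 0)) ↔
        (fun ν => (R : ℤ) * z' ν + ((f'.1 ν : ℕ) : ℤ)) = (fun ν => (R : ℤ) * z ν + ((j ν : ℕ) : ℤ)) + (fun ν => if ν = μ then ((τ : ℕ) : ℤ) else 0)) :=
    eventually_all.2 fun j => eventually_all.2 fun τ => eventually_castT_eq_castT_iff hs (R * N) hRN _ _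
  refine tendsto_const_nhds.congr' ?_
  filter_upwards [hev] with t ht
  congr 1
  rw [QB_apply]
  congr 1
  refine Finset.sum_congr rfl fun j _ => Finset.sum_congr rfl fun τ _ => if_congr ?_ rfl rfl
  rw [Prod.mk.injEq, cpt_castT_add_off, cpt_castT_add_off, tstep_eq_castT, ← castT_add]
  exact ((ht j τ).and Iff.rfl).symm

/-- **`tendsto_fromRows_eps_rho` — EL₂ OF THE STACKED ONE-STEP CONSTRAINT AT (STACKED, FINE) READINGS**: along `s t → ∞`, `Q_ax(ε(ẑ,g), ρ(ẑ′,f′))` converges for every stacked fibre index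
`g ∈ Fin d ⊕ Tr` and fine fibre index `f′` (averaging rows: `tendsto_re_QB_rho`; projection rows: `[(ẑ′,f′) = (ẑ,f)]` is eventually `[(z′,f′) = (z,f)]`). [folklore] -/
theorem tendsto_fromRows_eps_rho (hs : Tendsto s atTop atTop) (z : Fin d → ℤ)
    (g : Fin d ⊕ {f : (Fin d → Fin R) × Fin d // (∀ ν, ν < f.2 → ((f.1 ν : ℕ)) = 0) ∧ ((f.1 f.2 : ℕ)) + 1 < R}) (z' : Fin d → ℤ) (f' : (Fin d → Fin R) × Fin d) :
    ∃ c : ℝ, Tendsto (fun t => Matrix.fromRows (reM (QB N R (cubic d (s t))))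
        (fun (t' : {x : Tor (fine (R * N) (cubic d (s t))) × Fin d // (∀ ν, ν < x.2 → ((rem N R (cubic d (s t)) x.1 ν : ℕ)) = 0) ∧ ((rem N R (cubic d (s t)) x.1 x.2 : ℕ)) + 1 < R})
            (x : Tor (fine (R * N) (cubic d (s t))) × Fin d) =>
          if x = (Function.Embedding.subtype (fun x : Tor (fine (R * N) (cubic d (s t))) × Fin d =>
            (∀ ν, ν < x.2 → ((rem N R (cubic d (s t)) x.1 ν : ℕ)) = 0) ∧ ((rem N R (cubic d (s t)) x.1 x.2 : ℕ)) + 1 < R)) t' then (1 : ℝ) else 0)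
        (Sum.elim (fun μ : Fin d => (Sum.inl (castT (fine N (cubic d (s t))) z, μ) : (Tor (fine N (cubic d (s t))) × Fin d) ⊕
            {x : Tor (fine (R * N) (cubic d (s t))) × Fin d // (∀ ν, ν < x.2 → ((rem N R (cubic d (s t)) x.1 ν : ℕ)) = 0) ∧ ((rem N R (cubic d (s t)) x.1 x.2 : ℕ)) + 1 < R}))
          (fun f : {f : (Fin d → Fin R) × Fin d // (∀ ν, ν < f.2 → ((f.1 ν : ℕ)) = 0) ∧ ((f.1 f.2 : ℕ)) + 1 < R} =>
            Sum.inr ⟨(cpt N R (cubic d (s t)) (castT (fine N (cubic d (s t))) z) + off N R (cubic d (s t)) f.1.1, f.1.2), tree_cpt_add_off N R (cubic d (s t)) _ f⟩) g)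
        (cpt N R (cubic d (s t)) (castT (fine N (cubic d (s t))) z') + off N R (cubic d (s t)) f'.1, f'.2)) atTop (𝓝 c) := by
  classical
  rcases g with μ | f
  · obtain ⟨c, hc⟩ := tendsto_re_QB_rho N R s hs z μ z' f'
    refine ⟨c, hc.congr fun t => ?_⟩
    rw [fromRows_eps_inl, reM_apply]
  · have hN : 1 ≤ N := Nat.one_le_iff_ne_zero.mpr (NeZero.ne N)
    refine ⟨if (z' = z ∧ f' = f.1) then (1 : ℝ) else 0, tendsto_const_nhds.congr' ?_⟩
    filter_upwards [eventually_castT_eq_castT_iff hs N hN z' z] with t ht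
    rw [fromRows_eps_inr]
    refine if_congr ?_ rfl rfl
    constructor
    · rintro ⟨rfl, rfl⟩; rfl
    · intro h
      have h' := rho_injective N R (cubic d (s t)) (a₁ := (castT (fine N (cubic d (s t))) z', f')) (a₂ := (castT (fine N (cubic d (s t))) z, f.1)) h
      rw [Prod.mk.injEq] at h'
      exact ⟨ht.mp h'.1, h'.2⟩

/-- **`tendsto_reg_rho_rho` — EL₂ OF THE STACKED REGULARISER AT FINE READINGS**: along `s t → ∞` (`d ≥ 1`), `(Q_axᵀ(a•1)Q_ax)(ρ(ẑ,f), ρ(ẑ′,f′)) = a·Σ_β Q_ax(β,ρ(ẑ,f))Q_ax(β,ρ(ẑ′,f′))`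
converges: the sum over the stacked index is a sum over its presentation `ε` (PART 186 `eps_bijective`), i.e. a rectangular pair product over `Site × (Fin d ⊕ Tr)` of the complexified presented
constraint with itself — left factor bounded by `1`, right factor of finite range (`|Q_ax(β,x)| ≤ e·e^{−tdist(key β, par x)}`, keys and parents being the base coordinates), both EL₂ by
`tendsto_fromRows_eps_rho` (PART 185 `tendsto_mul_pair₃`). [folklore] -/
theorem tendsto_reg_rho_rho (hd : 1 ≤ d) (hs : Tendsto s atTop atTop) (a : ℝ) (f f' : (Fin d → Fin R) × Fin d) (z z' : Fin d → ℤ) :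
    ∃ c : ℝ, Tendsto (fun t =>
      ((Matrix.fromRows (reM (QB N R (cubic d (s t))))
        (fun (t' : {x : Tor (fine (R * N) (cubic d (s t))) × Fin d // (∀ ν, ν < x.2 → ((rem N R (cubic d (s t)) x.1 ν : ℕ)) = 0) ∧ ((rem N R (cubic d (s t)) x.1 x.2 : ℕ)) + 1 < R})
            (x : Tor (fine (R * N) (cubic d (s t))) × Fin d) =>
          if x = (Function.Embedding.subtype (fun x : Tor (fine (R * N) (cubic d (s t))) × Fin d =>
            (∀ ν, ν < x.2 → ((rem N R (cubic d (s t)) x.1 ν : ℕ)) = 0) ∧ ((rem N R (cubic d (s t)) x.1 x.2 : ℕ)) + 1 < R)) t' then (1 : ℝ) else 0))ᵀ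
        * (a • (1 : Matrix ((Tor (fine N (cubic d (s t))) × Fin d) ⊕ {x : Tor (fine (R * N) (cubic d (s t))) × Fin d // (∀ ν, ν < x.2 → ((rem N R (cubic d (s t)) x.1 ν : ℕ)) = 0) ∧ ((rem N R (cubic d (s t)) x.1 x.2 : ℕ)) + 1 < R})
            ((Tor (fine N (cubic d (s t))) × Fin d) ⊕ {x : Tor (fine (R * N) (cubic d (s t))) × Fin d // (∀ ν, ν < x.2 → ((rem N R (cubic d (s t)) x.1 ν : ℕ)) = 0) ∧ ((rem N R (cubic d (s t)) x.1 x.2 : ℕ)) + 1 < R}) ℝ))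
        * Matrix.fromRows (reM (QB N R (cubic d (s t))))
          (fun (t' : {x : Tor (fine (R * N) (cubic d (s t))) × Fin d // (∀ ν, ν < x.2 → ((rem N R (cubic d (s t)) x.1 ν : ℕ)) = 0) ∧ ((rem N R (cubic d (s t)) x.1 x.2 : ℕ)) + 1 < R})
              (x : Tor (fine (R * N) (cubic d (s t))) × Fin d) =>
            if x = (Function.Embedding.subtype (fun x : Tor (fine (R * N) (cubic d (s t))) × Fin d =>
              (∀ ν, ν < x.2 → ((rem N R (cubic d (s t)) x.1 ν : ℕ)) = 0) ∧ ((rem N R (cubic d (s t)) x.1 x.2 : ℕ)) + 1 < R)) t' then (1 : ℝ) else 0))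
        (cpt N R (cubic d (s t)) (castT (fine N (cubic d (s t))) z) + off N R (cubic d (s t)) f.1, f.2)
        (cpt N R (cubic d (s t)) (castT (fine N (cubic d (s t))) z') + off N R (cubic d (s t)) f'.1, f'.2)) atTop (𝓝 c) := by
  classical
  have hd0 : (0 : ℝ) < d := by exact_mod_cast lt_of_lt_of_le zero_lt_one hd
  have hside : Tendsto (fun t => N * s t) atTop atTop :=
    Filter.tendsto_atTop_mono (fun t => Nat.le_mul_of_pos_left _ (Nat.pos_of_ne_zero (NeZero.ne N))) hs
  obtain ⟨S, hS⟩ := tendsto_mul_pair₃ (d := d) (side := fun t => N * s t) hside (F := (Fin d → Fin R) × Fin d)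
    (G := Fin d ⊕ {f : (Fin d → Fin R) × Fin d // (∀ ν, ν < f.2 → ((f.1 ν : ℕ)) = 0) ∧ ((f.1 f.2 : ℕ)) + 1 < R}) (H := (Fin d → Fin R) × Fin d)
    (X := fun t => Matrix.of fun (r : Tor (fine N (cubic d (s t))) × ((Fin d → Fin R) × Fin d))
        (b : Tor (fine N (cubic d (s t))) × (Fin d ⊕ {f : (Fin d → Fin R) × Fin d // (∀ ν, ν < f.2 → ((f.1 ν : ℕ)) = 0) ∧ ((f.1 f.2 : ℕ)) + 1 < R})) =>
      ((Matrix.fromRows (reM (QB N R (cubic d (s t))))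
        (fun (t' : {x : Tor (fine (R * N) (cubic d (s t))) × Fin d // (∀ ν, ν < x.2 → ((rem N R (cubic d (s t)) x.1 ν : ℕ)) = 0) ∧ ((rem N R (cubic d (s t)) x.1 x.2 : ℕ)) + 1 < R})
            (x : Tor (fine (R * N) (cubic d (s t))) × Fin d) =>
          if x = (Function.Embedding.subtype (fun x : Tor (fine (R * N) (cubic d (s t))) × Fin d =>
            (∀ ν, ν < x.2 → ((rem N R (cubic d (s t)) x.1 ν : ℕ)) = 0) ∧ ((rem N R (cubic d (s t)) x.1 x.2 : ℕ)) + 1 < R)) t' then (1 : ℝ) else 0)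
        (Sum.elim (fun μ : Fin d => (Sum.inl (b.1, μ) : (Tor (fine N (cubic d (s t))) × Fin d) ⊕
            {x : Tor (fine (R * N) (cubic d (s t))) × Fin d // (∀ ν, ν < x.2 → ((rem N R (cubic d (s t)) x.1 ν : ℕ)) = 0) ∧ ((rem N R (cubic d (s t)) x.1 x.2 : ℕ)) + 1 < R}))
          (fun g : {f : (Fin d → Fin R) × Fin d // (∀ ν, ν < f.2 → ((f.1 ν : ℕ)) = 0) ∧ ((f.1 f.2 : ℕ)) + 1 < R} =>
            Sum.inr ⟨(cpt N R (cubic d (s t)) b.1 + off N R (cubic d (s t)) g.1.1, g.1.2), tree_cpt_add_off N R (cubic d (s t)) _ g⟩) b.2)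
        (cpt N R (cubic d (s t)) r.1 + off N R (cubic d (s t)) r.2.1, r.2.2) : ℝ) : ℂ))
    (Y := fun t => Matrix.of fun (b : Tor (fine N (cubic d (s t))) × (Fin d ⊕ {f : (Fin d → Fin R) × Fin d // (∀ ν, ν < f.2 → ((f.1 ν : ℕ)) = 0) ∧ ((f.1 f.2 : ℕ)) + 1 < R}))
        (r : Tor (fine N (cubic d (s t))) × ((Fin d → Fin R) × Fin d)) =>
      ((Matrix.fromRows (reM (QB N R (cubic d (s t))))
        (fun (t' : {x : Tor (fine (R * N) (cubic d (s t))) × Fin d // (∀ ν, ν < x.2 → ((rem N R (cubic d (s t)) x.1 ν : ℕ)) = 0) ∧ ((rem N R (cubic d (s t)) x.1 x.2 : ℕ)) + 1 < R})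
            (x : Tor (fine (R * N) (cubic d (s t))) × Fin d) =>
          if x = (Function.Embedding.subtype (fun x : Tor (fine (R * N) (cubic d (s t))) × Fin d =>
            (∀ ν, ν < x.2 → ((rem N R (cubic d (s t)) x.1 ν : ℕ)) = 0) ∧ ((rem N R (cubic d (s t)) x.1 x.2 : ℕ)) + 1 < R)) t' then (1 : ℝ) else 0)
        (Sum.elim (fun μ : Fin d => (Sum.inl (b.1, μ) : (Tor (fine N (cubic d (s t))) × Fin d) ⊕
            {x : Tor (fine (R * N) (cubic d (s t))) × Fin d // (∀ ν, ν < x.2 → ((rem N R (cubic d (s t)) x.1 ν : ℕ)) = 0) ∧ ((rem N R (cubic d (s t)) x.1 x.2 : ℕ)) + 1 < R}))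
          (fun g : {f : (Fin d → Fin R) × Fin d // (∀ ν, ν < f.2 → ((f.1 ν : ℕ)) = 0) ∧ ((f.1 f.2 : ℕ)) + 1 < R} =>
            Sum.inr ⟨(cpt N R (cubic d (s t)) b.1 + off N R (cubic d (s t)) g.1.1, g.1.2), tree_cpt_add_off N R (cubic d (s t)) _ g⟩) b.2)
        (cpt N R (cubic d (s t)) r.1 + off N R (cubic d (s t)) r.2.1, r.2.2) : ℝ) : ℂ))
    (B := 1) (C := Real.exp 1) (δ := 1 / d) zero_le_one (Real.exp_pos 1).le
    (fun t x f₁ w g => by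
      rw [Matrix.of_apply, Complex.norm_real, Real.norm_eq_abs]
      exact abs_fromRows_le_one N R (cubic d (s t)) _ _ _)
    (fun t w g y h => by
      rw [Matrix.of_apply, Complex.norm_real, Real.norm_eq_abs]
      refine (abs_fromRows_le_exp N R (cubic d (s t)) _ _ _).trans ?_
      rw [key_eps, par_cpt_add_off]
      exact mul_le_mul_of_nonneg_left (exp_neg_tdist_le_exp_window hd (N * s t) zero_le_one w y) (Real.exp_pos 1).le)
    (div_pos one_pos hd0)
    (fun f₁ g u u' => by
      obtain ⟨c, hc⟩ := tendsto_fromRows_eps_rho N R s hs u' g u f₁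
      exact ⟨(c : ℂ), ((Complex.continuous_ofReal.tendsto c).comp hc).congr fun t => rfl⟩)
    (fun g h u u' => by
      obtain ⟨c, hc⟩ := tendsto_fromRows_eps_rho N R s hs u g u' h
      exact ⟨(c : ℂ), ((Complex.continuous_ofReal.tendsto c).comp hc).congr fun t => rfl⟩)
    f f' z z'
  refine ⟨a * S.re, (((Complex.continuous_re.tendsto S).comp hS).const_mul a).congr fun t => ?_⟩
  simp only [Function.comp_apply]
  rw [transpose_mul_smul_one_mul, Matrix.smul_apply, smul_eq_mul, Matrix.mul_apply]
  congr 1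
  rw [Matrix.mul_apply, Complex.re_sum]
  rw [← (eps_bijective N R (cubic d (s t))).sum_comp (fun β => _ * _)]
  refine Finset.sum_congr rfl fun b _ => ?_
  rw [Matrix.of_apply, Matrix.of_apply, ← Complex.ofReal_mul, Complex.ofReal_re, Matrix.transpose_apply]

end Constraint

/-! ## §2 Inverses at block-fibred readings: PART 144 for a real symmetric fine family presented by `ρ` -/

section InverseRho

/-- **`tendsto_inv_rho_of_letters` — EL₂ OF THE INVERSE OF A LOCALISED, WELL-CONDITIONED REAL SYMMETRIC FINE FAMILY, AT BLOCK-FIBRED READINGS** (`d ≥ 1`): along `s t → ∞`, a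
family `K_t` of real matrices on the fine bonds `Tor (fine (R·N) (cubic d (s t))) × Fin d` with, UNIFORMLY in `t`, `K_tᵀ = K_t`, `γ|u|² ≤ ⟨u,K_tu⟩ ≤ Λ|u|²` (`0 < γ`), the block entry decay
`|K_t(x,x′)| ≤ C·e^{−δ·tdist(par x, par x′)}` (`δ > 0`, `C ≥ 0`; `γ ≤ Λ` follows on a unit vector) and EL₂ at the readings `ρ(ẑ,f)`, has `K_t⁻¹` with EL₂ at those readings — PART 144 `exists_tendsto_inv_pair` for the
complexified presentation `(K_t∘(ρ,ρ)) ⊗ ℂ` on `Site d (N·s t) × ((Fin d → Fin R) × Fin d)` ((a) PART 185's Neumann ratio `1 − γ∕Λ`, (b) window decay at rate `δ∕d` since `par ∘ ρ = Prod.fst`,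
(c) by continuity of `ofReal`), read back through `(K∘(ρ,ρ))⁻¹ = K⁻¹∘(ρ,ρ)` and `(B ⊗ ℂ)⁻¹ = B⁻¹ ⊗ ℂ`. [folklore] -/
theorem tendsto_inv_rho_of_letters (hd : 1 ≤ d) (hs : Tendsto s atTop atTop)
    {K : (t : ℕ) → Matrix (Tor (fine (R * N) (cubic d (s t))) × Fin d) (Tor (fine (R * N) (cubic d (s t))) × Fin d) ℝ}
    (hKsym : ∀ t, (K t)ᵀ = K t) {γ Λ : ℝ} (hγ : 0 < γ) (hlo : ∀ t, QGQInverse.Coercive (K t) γ)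
    (hhi : ∀ t (u : Tor (fine (R * N) (cubic d (s t))) × Fin d → ℝ), u ⬝ᵥ (K t *ᵥ u) ≤ Λ * (u ⬝ᵥ u))
    {C δ : ℝ} (hC : 0 ≤ C) (hδ : 0 < δ)
    (hdec : ∀ t (x x' : Tor (fine (R * N) (cubic d (s t))) × Fin d),
      |K t x x'| ≤ C * Real.exp (-(δ * (tdist (par N R (cubic d (s t)) x.1) (par N R (cubic d (s t)) x'.1) : ℝ))))
    (hlim : ∀ (f f' : (Fin d → Fin R) × Fin d) (z z' : Fin d → ℤ), ∃ c : ℝ,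
      Tendsto (fun t => K t (cpt N R (cubic d (s t)) (castT (fine N (cubic d (s t))) z) + off N R (cubic d (s t)) f.1, f.2)
        (cpt N R (cubic d (s t)) (castT (fine N (cubic d (s t))) z') + off N R (cubic d (s t)) f'.1, f'.2)) atTop (𝓝 c))
    (f f' : (Fin d → Fin R) × Fin d) (z z' : Fin d → ℤ) :
    ∃ c : ℝ, Tendsto (fun t => (K t)⁻¹ (cpt N R (cubic d (s t)) (castT (fine N (cubic d (s t))) z) + off N R (cubic d (s t)) f.1, f.2)
      (cpt N R (cubic d (s t)) (castT (fine N (cubic d (s t))) z') + off N R (cubic d (s t)) f'.1, f'.2)) atTop (𝓝 c) := by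
  have hd0 : (0 : ℝ) < d := by exact_mod_cast lt_of_lt_of_le zero_lt_one hd
  -- `γ ≤ Λ`: test the two form bounds on a unit vector of the (nonempty) fine bond lattice at `t = 0`
  have hγΛ : γ ≤ Λ := by
    have x₀ : Tor (fine (R * N) (cubic d (s 0))) × Fin d := (0, ⟨0, hd⟩)
    have h1 := hlo 0 (Pi.single x₀ 1)
    have h2 := hhi 0 (Pi.single x₀ 1)
    have e1 : (Pi.single x₀ (1 : ℝ)) ⬝ᵥ (Pi.single x₀ 1) = 1 := by rw [single_dotProduct, Pi.single_eq_same, mul_one]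
    rw [e1, mul_one] at h1 h2
    exact h1.trans h2
  have hΛ0 : 0 < Λ := lt_of_lt_of_le hγ hγΛ
  have hside : Tendsto (fun t => N * s t) atTop atTop :=
    Filter.tendsto_atTop_mono (fun t => Nat.le_mul_of_pos_left _ (Nat.pos_of_ne_zero (NeZero.ne N))) hs
  -- the complexified presentation over the coarse torus
  obtain ⟨S, hS⟩ := exists_tendsto_inv_pair (d := d) (F := (Fin d → Fin R) × Fin d) (side := fun t => N * s t) hside
    (A := fun t => (((K t).submatrix (fun p : Tor (fine N (cubic d (s t))) × ((Fin d → Fin R) × Fin d) => ((cpt N R (cubic d (s t)) p.1 + off N R (cubic d (s t)) p.2.1, p.2.2) : Tor (fine (R * N) (cubic d (s t))) × Fin d))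
      (fun p : Tor (fine N (cubic d (s t))) × ((Fin d → Fin R) × Fin d) => ((cpt N R (cubic d (s t)) p.1 + off N R (cubic d (s t)) p.2.1, p.2.2) : Tor (fine (R * N) (cubic d (s t))) × Fin d))).map ((↑) : ℝ → ℂ)))
    (τ := (((Λ⁻¹ : ℝ)) : ℂ)) (q := 1 - γ / Λ) (C := C) (δ := δ / d)
    (fun t => opNorm_one_sub_smul_map_ofReal_le (transpose_submatrix_eq _ (hKsym t)) hγ hγΛ (coercive_submatrix (rho_bijective N R (cubic d (s t))) (hlo t))
      (form_le_submatrix (rho_bijective N R (cubic d (s t))) (hhi t)))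
    (by have : 0 < γ / Λ := div_pos hγ hΛ0; linarith)
    (fun t w g y h => by
      rw [Matrix.map_apply, Matrix.submatrix_apply, Complex.norm_real, Real.norm_eq_abs]
      refine (hdec t _ _).trans ?_
      rw [par_cpt_add_off, par_cpt_add_off]
      exact mul_le_mul_of_nonneg_left (exp_neg_tdist_le_exp_window hd (N * s t) hδ.le w y) hC)
    (div_pos hδ hd0)
    (fun f₁ g₁ u u' => by
      obtain ⟨c, hc⟩ := hlim f₁ g₁ u u'
      exact ⟨(c : ℂ), ((Complex.continuous_ofReal.tendsto c).comp hc).congr fun t => rfl⟩)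
    f f' z z'
  refine ⟨S.re, ((Complex.continuous_re.tendsto S).comp hS).congr fun t => ?_⟩
  have hunit : IsUnit ((K t).submatrix (fun p : Tor (fine N (cubic d (s t))) × ((Fin d → Fin R) × Fin d) => ((cpt N R (cubic d (s t)) p.1 + off N R (cubic d (s t)) p.2.1, p.2.2) : Tor (fine (R * N) (cubic d (s t))) × Fin d))
      (fun p : Tor (fine N (cubic d (s t))) × ((Fin d → Fin R) × Fin d) => ((cpt N R (cubic d (s t)) p.1 + off N R (cubic d (s t)) p.2.1, p.2.2) : Tor (fine (R * N) (cubic d (s t))) × Fin d))).det :=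
    isUnit_det_of_coercive_fine hγ (coercive_submatrix (rho_bijective N R (cubic d (s t))) (hlo t))
  simp only [Function.comp_apply]
  rw [map_ofReal_inv hunit, inv_submatrix_of_bijective (rho_bijective N R (cubic d (s t))), Matrix.map_apply, Matrix.submatrix_apply, Complex.ofReal_re]

variable {Kf : ℝ → ℝ}

/-- **`tendsto_inv_regFormAx_rho` — EL₂ OF THE SOFT RESOLVENT `K_t⁻¹`, `K_t = H_t + Q_axᵀ(a•1)Q_ax`, AT FINE READINGS** (`d ≥ 1`; census V201′ (ε) step 1, generic in the fine form):
for a volume-indexed family `H_t` of symmetric fine forms with `t`-UNIFORM block entry decay `(h₀, δ_H)`, a `t`-uniform site profile `Kf`, a `t`-uniform coercivity `γ_K` of `K_t` (INPUT —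
PART 178 ∕ 179 ∕ 181 supply it) and EL₂ at fine readings, `K_t⁻¹` has EL₂ at fine readings: `tendsto_inv_rho_of_letters` with the symmetric Schur bound `Λ_K = c_K·(d·R^d·Kf(δ_H))`
(PART 181 `form_le_of_entry_decay_par` on PART 180's entry decay of `K_t`) and EL₂ of `K_t` = EL₂ of `H_t` + `tendsto_reg_rho_rho`. [folklore] -/
theorem tendsto_inv_regFormAx_rho (hd : 1 ≤ d) (hs : Tendsto s atTop atTop)
    (hKf : ∀ s' : ℝ, 0 < s' → ∀ t (y : Tor (fine N (cubic d (s t)))), ∑ y' : Tor (fine N (cubic d (s t))), Real.exp (-(s' * (tdist y y' : ℝ))) ≤ Kf s')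
    {H : (t : ℕ) → Matrix (Tor (fine (R * N) (cubic d (s t))) × Fin d) (Tor (fine (R * N) (cubic d (s t))) × Fin d) ℝ} (hH : ∀ t, (H t)ᵀ = H t)
    {a h₀ δH γK : ℝ} (ha : 0 < a) (hh₀ : 0 ≤ h₀) (hδH : 0 < δH) (hγK : 0 < γK)
    (hHent : ∀ t (x x' : Tor (fine (R * N) (cubic d (s t))) × Fin d), |H t x x'| ≤ h₀ * Real.exp (-(δH * (tdist (par N R (cubic d (s t)) x.1) (par N R (cubic d (s t)) x'.1) : ℝ))))
    (hK : ∀ t, QGQInverse.Coercive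
      (H t + (Matrix.fromRows (reM (QB N R (cubic d (s t))))
        (fun (t' : {x : Tor (fine (R * N) (cubic d (s t))) × Fin d // (∀ ν, ν < x.2 → ((rem N R (cubic d (s t)) x.1 ν : ℕ)) = 0) ∧ ((rem N R (cubic d (s t)) x.1 x.2 : ℕ)) + 1 < R})
            (x : Tor (fine (R * N) (cubic d (s t))) × Fin d) =>
          if x = (Function.Embedding.subtype (fun x : Tor (fine (R * N) (cubic d (s t))) × Fin d =>
            (∀ ν, ν < x.2 → ((rem N R (cubic d (s t)) x.1 ν : ℕ)) = 0) ∧ ((rem N R (cubic d (s t)) x.1 x.2 : ℕ)) + 1 < R)) t' then (1 : ℝ) else 0))ᵀ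
        * (a • (1 : Matrix ((Tor (fine N (cubic d (s t))) × Fin d) ⊕ {x : Tor (fine (R * N) (cubic d (s t))) × Fin d // (∀ ν, ν < x.2 → ((rem N R (cubic d (s t)) x.1 ν : ℕ)) = 0) ∧ ((rem N R (cubic d (s t)) x.1 x.2 : ℕ)) + 1 < R})
            ((Tor (fine N (cubic d (s t))) × Fin d) ⊕ {x : Tor (fine (R * N) (cubic d (s t))) × Fin d // (∀ ν, ν < x.2 → ((rem N R (cubic d (s t)) x.1 ν : ℕ)) = 0) ∧ ((rem N R (cubic d (s t)) x.1 x.2 : ℕ)) + 1 < R}) ℝ))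
        * Matrix.fromRows (reM (QB N R (cubic d (s t))))
          (fun (t' : {x : Tor (fine (R * N) (cubic d (s t))) × Fin d // (∀ ν, ν < x.2 → ((rem N R (cubic d (s t)) x.1 ν : ℕ)) = 0) ∧ ((rem N R (cubic d (s t)) x.1 x.2 : ℕ)) + 1 < R})
              (x : Tor (fine (R * N) (cubic d (s t))) × Fin d) =>
            if x = (Function.Embedding.subtype (fun x : Tor (fine (R * N) (cubic d (s t))) × Fin d =>
              (∀ ν, ν < x.2 → ((rem N R (cubic d (s t)) x.1 ν : ℕ)) = 0) ∧ ((rem N R (cubic d (s t)) x.1 x.2 : ℕ)) + 1 < R)) t' then (1 : ℝ) else 0)) γK)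
    (hHlim : ∀ (f f' : (Fin d → Fin R) × Fin d) (z z' : Fin d → ℤ), ∃ c : ℝ,
      Tendsto (fun t => H t (cpt N R (cubic d (s t)) (castT (fine N (cubic d (s t))) z) + off N R (cubic d (s t)) f.1, f.2)
        (cpt N R (cubic d (s t)) (castT (fine N (cubic d (s t))) z') + off N R (cubic d (s t)) f'.1, f'.2)) atTop (𝓝 c))
    (f f' : (Fin d → Fin R) × Fin d) (z z' : Fin d → ℤ) :
    ∃ c : ℝ, Tendsto (fun t =>
      (H t + (Matrix.fromRows (reM (QB N R (cubic d (s t))))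
        (fun (t' : {x : Tor (fine (R * N) (cubic d (s t))) × Fin d // (∀ ν, ν < x.2 → ((rem N R (cubic d (s t)) x.1 ν : ℕ)) = 0) ∧ ((rem N R (cubic d (s t)) x.1 x.2 : ℕ)) + 1 < R})
            (x : Tor (fine (R * N) (cubic d (s t))) × Fin d) =>
          if x = (Function.Embedding.subtype (fun x : Tor (fine (R * N) (cubic d (s t))) × Fin d =>
            (∀ ν, ν < x.2 → ((rem N R (cubic d (s t)) x.1 ν : ℕ)) = 0) ∧ ((rem N R (cubic d (s t)) x.1 x.2 : ℕ)) + 1 < R)) t' then (1 : ℝ) else 0))ᵀ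
        * (a • (1 : Matrix ((Tor (fine N (cubic d (s t))) × Fin d) ⊕ {x : Tor (fine (R * N) (cubic d (s t))) × Fin d // (∀ ν, ν < x.2 → ((rem N R (cubic d (s t)) x.1 ν : ℕ)) = 0) ∧ ((rem N R (cubic d (s t)) x.1 x.2 : ℕ)) + 1 < R})
            ((Tor (fine N (cubic d (s t))) × Fin d) ⊕ {x : Tor (fine (R * N) (cubic d (s t))) × Fin d // (∀ ν, ν < x.2 → ((rem N R (cubic d (s t)) x.1 ν : ℕ)) = 0) ∧ ((rem N R (cubic d (s t)) x.1 x.2 : ℕ)) + 1 < R}) ℝ))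
        * Matrix.fromRows (reM (QB N R (cubic d (s t))))
          (fun (t' : {x : Tor (fine (R * N) (cubic d (s t))) × Fin d // (∀ ν, ν < x.2 → ((rem N R (cubic d (s t)) x.1 ν : ℕ)) = 0) ∧ ((rem N R (cubic d (s t)) x.1 x.2 : ℕ)) + 1 < R})
              (x : Tor (fine (R * N) (cubic d (s t))) × Fin d) =>
            if x = (Function.Embedding.subtype (fun x : Tor (fine (R * N) (cubic d (s t))) × Fin d =>
              (∀ ν, ν < x.2 → ((rem N R (cubic d (s t)) x.1 ν : ℕ)) = 0) ∧ ((rem N R (cubic d (s t)) x.1 x.2 : ℕ)) + 1 < R)) t' then (1 : ℝ) else 0))⁻¹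
        (cpt N R (cubic d (s t)) (castT (fine N (cubic d (s t))) z) + off N R (cubic d (s t)) f.1, f.2)
        (cpt N R (cubic d (s t)) (castT (fine N (cubic d (s t))) z') + off N R (cubic d (s t)) f'.1, f'.2)) atTop (𝓝 c) := by
  classical
  -- the entry-decay letter of `K_t` (PART 180) and its symmetric Schur bound (PART 181)
  have hcK0 : 0 ≤ (h₀ + a * (((R : ℝ) ^ d)⁻¹ * ((R : ℝ) ^ d)⁻¹) * Real.exp (2 * δH)) + a := by positivity
  refine tendsto_inv_rho_of_letters N R s hd hs (fun t => transpose_reg (hH t) a) hγK hK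
    (Λ := ((h₀ + a * (((R : ℝ) ^ d)⁻¹ * ((R : ℝ) ^ d)⁻¹) * Real.exp (2 * δH)) + a) * ((d : ℝ) * (R : ℝ) ^ d * Kf δH))
    (fun t u => form_le_of_entry_decay_par N R (cubic d (s t)) (transpose_reg (hH t) a) (fun s' hs' y => hKf s' hs' t y) hcK0 hδH
      (fun x x' => abs_regFormAx_apply_le N R (cubic d (s t)) _ ha.le hδH.le (hHent t) x x') u)
    hcK0 hδH (fun t x x' => abs_regFormAx_apply_le N R (cubic d (s t)) _ ha.le hδH.le (hHent t) x x') (fun f₁ f₁' u u' => ?_) f f' z z'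
  obtain ⟨c₁, hc₁⟩ := hHlim f₁ f₁' u u'
  obtain ⟨c₂, hc₂⟩ := tendsto_reg_rho_rho N R s hd hs a f₁ f₁' u u'
  exact ⟨c₁ + c₂, (hc₁.add hc₂).congr fun t => by rw [Matrix.add_apply]⟩

end InverseRho


end Summit.QuantumFields.BalabanUV.Beta.GAN24.OneStepConstraintAxialVolumeLetters

end
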